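import Summits.SmoothPoincare4.SmoothPoincare4.Theses.SymplecticOrigami
import Summits.SmoothPoincare4.SmoothPoincare4.Theorems.NoGenusTwoDoor.Negative.NoncompactDoor
import Summits.SmoothPoincare4.SmoothPoincare4.Theorems.SymplecticOrigamiNoGenusTwoDoorStubTaubesCanonicalCurve
import Summits.SmoothPoincare4.SmoothPoincare4.Theorems.SymplecticOrigamiNoGenusTwoDoorStubRankOneFlatComplement
import Summits.SmoothPoincare4.SmoothPoincare4.Theorems.SymplecticOrigamiNoGenusTwoDoorStubLiouvillePackaging
import Summits.SmoothPoincare4.SmoothPoincare4.Theorems.SymplecticOrigamiNoGenusTwoDoorStubClosingUp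
import Literature.Geometry.Symplectic.ThomGysinComplementSurfaceFour
import Literature.Geometry.Symplectic.SublevelPreconnectedOfRegular
import Literature.Geometry.Symplectic.CodimTwoComplementConnected
import Literature.Geometry.Symplectic.McleanDivisorComplementConvexFourProofs
import Summits.SmoothPoincare4.SmoothPoincare4.Theorems.SymplecticOrigamiNoGenusTwoDoorStubTaubesCanonicalCurveOfLiLiu
import Literature.AlgebraicTopology.SingularHomology.SingularChains
import Literature.Geometry.Kaehler.ManifoldFormsPullback
import Literature.Geometry.Symplectic.SteinDomain

/-!
# Skeleton line `canonical-cap-filling` for crux `NoGenusTwoDoor` (stmt-SmoothPoincare4-7842)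

**Lead reshape r4 (prover-line-stmt-SmoothPoincare4-7842-c7-0, 2026-08-17; = route-choice
rchoice-c6f26cbb's re-routing, which that planner could not `crux write`).**  S1
`stub_taubesCanonicalCurve` is now closed MODULO EXACTLY THE TWO PRINTED THEOREMS A DOOR CONSUMES —
Hirzebruch's `c₁² = 2χ + 3σ` for closed almost complex `4`-manifolds
(`Literature.Geometry.Symplectic.hirzebruch_firstChernClass_sq_eq_almostComplex_four`, itself reduced
in the tree to Thom's `Ω₄^SO ↪ ℤ` / Kirby VIII Thm 1 (A), `…_of_kirby`) and Li–Liu's `SW ⇒ Gr` for the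
canonical class at `b⁺ = 1` (`Literature.Geometry.Symplectic.liLiu1995_hasTaubesCurve_canonicalClass_of_bPlus_eq_one`)
— by the LANDED tree theorem `…Theorems.NoGenusTwoDoor.CanonicalCapFilling.stub_taubesCanonicalCurve_of_liLiu`
(p141385): a door has `b₂ = 1`, hence `b⁺ = 1`, so Taubes 1995 Thm. A (1) for `b⁺ ≥ 2`
(`taubes1995_hasTaubesCurve_canonicalClass_of_two_le_bPlus`, the third input of the umbrella fact's
tree reduction `taubes_canonicalClass_symplecticCurve_four_of_split`) is IDLE on doors and no longer
appears in this skeleton (`import …TaubesCanonicalClassSymplecticCurveFourSplit` replaced by the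
`…OfLiLiu` Theorems module; `stub_taubesCanonicalCurve_closedModuloLiLiu`, `taubesCanonicalCurve_of_liLiu`,
`ClosedModuloPrintedFacts : hirzebruch_… → liLiu1995_… → FlatFillingExclusion → NoGenusTwoDoor`,
`flatFillingExclusion_iff (hB) (hC₁) (hA)`).  The Theorems-side twin is
`noGenusTwoDoor_of_flatFillingExclusion_of_hirzebruch_of_liLiu` (`…ReductionR3LiLiu.lean`, p142513).
Registered stubs S1, S4 and `NoGenusTwoDoor_of` are BYTE-IDENTICAL to r3; `sorry` count 2 (S1 = pure
named-fact debt {Kirby VIII.1(A) cobordism, Li–Liu gauge theory}; S4 = the crux in filling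
coordinates, open).

**Lead reshape r3 (prover-line-stmt-SmoothPoincare4-7842-c6-0, 2026-08-17).**  S3
`stub_liouvillePackaging` is now CLOSED UNCONDITIONALLY: its one remaining named-fact input,
McLean's `Literature.Geometry.Symplectic.mclean_divisorComplement_convex_four`, was DISCHARGED in
the tree (`mclean_divisorComplement_convex_four_holds`, `McleanDivisorComplementConvexFourProofs.lean`,
2026-08-16T21:17Z — after r2), so S3 below is the term
`stub_liouvillePackaging_of_mclean mclean_…_holds isConnected_…_holds isPreconnected_…_holds`
— LANDED as `Theorems/SymplecticOrigamiNoGenusTwoDoorStubLiouvillePackagingHolds.lean` (p140840; the same term).  Registered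
`sorry` stubs after r3: S1 `stub_taubesCanonicalCurve` (a theorem in print; closed modulo the named
fact `taubes_canonicalClass_symplecticCurve_four`, itself reduced in the tree to exactly its three
printed inputs — Hirzebruch's `c₁² = 2χ + 3σ`, Taubes 1995 Thm. A (1) for `b⁺ ≥ 2`, Li–Liu 1995 for
`b⁺ = 1` — by `taubes_canonicalClass_symplecticCurve_four_of_split`, see
`stub_taubesCanonicalCurve_closedModuloSplit`) and S4 `stub_flatFillingExclusion` (open ⟺ crux).
The composition is now `NoGenusTwoDoor_of : S1 → S4 → NoGenusTwoDoor` (S2, S3 enter as theorems),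
and `closedModuloFacts : taubes_… → FlatFillingExclusion → NoGenusTwoDoor`: the crux is CLOSED
MODULO ONE named published fact (Taubes–Li–Liu `SW ⇒ Gr`) and S4; `flatFillingExclusion_iff` needs
only the Taubes and `K² = 2χ + 3σ`/adjunction facts.

**Lead reshape r2 (prover-line-stmt-SmoothPoincare4-7842-0, 2026-08-16, after wave 1).**  Four of
the five stubs are now CLOSED from the tree: S2 `stub_rankOneFlatComplement` LANDED unconditionally
(p90504); S1, S3, S5 landed as conditionals on named Literature facts (S1 p87978 modulo
`Literature.Geometry.Symplectic.taubes_canonicalClass_symplecticCurve_four` — Taubes SW⇒Gr + Li–Liu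
wall-crossing, p87835 — the Thom–Gysin input being DISCHARGED in tree
(`thomGysin_complement_surface_four_holds`); S3 p92246 modulo
`…mclean_divisorComplement_convex_four` (McLean 2012 L.5.17) and
`…isConnected_compl_range_of_isSmoothEmbedding` (Kosinski X.1), the Milnor sublevel input
DISCHARGED (p92945); S5 p94063 modulo the tree fact `…canonicalClass_sq_and_adjunction_of_symplectic_four`,
its `b₂ = 1` half unconditional).  Registered stubs after r2: S1 `stub_taubesCanonicalCurve` and
S3 `stub_liouvillePackaging` (theorems in print, formally `sorry` here, CLOSED MODULO their named
facts — see `stub_*_closedModulo`) and S4 `stub_flatFillingExclusion` (open ⟺ crux); S2 and S5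
are imported tree theorems.  `NoGenusTwoDoor_of : S1 → S3 → S4 → NoGenusTwoDoor` is the checked
composition; `closedModuloFacts : taubes_… → mclean_… → FlatFillingExclusion → NoGenusTwoDoor`
(the codimension-2 connectedness input being DISCHARGED in tree,
`isConnected_compl_range_of_isSmoothEmbedding_holds`) shows the crux is CLOSED MODULO two named
published facts (Taubes SW⇒Gr at b⁺ = 1; McLean's convex divisor complement) and S4.

**Lead reshape r1 (prover-line-stmt-SmoothPoincare4-7842-0, 2026-08-16).**  Same five stubs and
same composition as the planner's skeleton (planner-cruxplan-…-canonical-cap-fillin-0, triage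
r1-1/2/3 PASS ×3); the ONLY change is that every registered `stub_*` signature is now UNFOLDED to
tree / Mathlib terms (no local `def` occurs inside a registered signature), so that stub workers can
land each stub verbatim in a `Theorems/SymplecticOrigamiNoGenusTwoDoor<Stub>.lean` file (which may
not import this `Cruxes/` work file) and the lead can import the landed theorem and delete the
`sorry` — the device used by the sibling line `Cruxes/OrigamiRung/Lines/pair-rigidity-endgame.lean`.
The readable abbreviations (`IsSymplecticMForm`, `IsSymplecticSurface`, `MeridianInjective`,
`IsFlat`, `IsExactOn`, `HasLiouvillePackaging`) are kept below as DOCUMENTATION and are proved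
equal to the unfolded clauses by `Iff.rfl` (`*_iff`), but nothing registered depends on them.

Route `SymplecticOrigami`, crux r2 `NoGenusTwoDoor` (D, the DOOR: no closed connected symplectic
4-manifold `(N, s)` has `(b₁, b₂) = (2, 1)`).  Idea card `Ideas/canonical-cap-filling.md`, line
card `Lines/canonical-cap-filling.md`, standing disprover `Cruxes/NoGenusTwoDoor/Disproof.lean`
v3 (gen 2; read 2026-08-16 incl. §7–§10), lead's choice `PICKED.md`.

THE LINE.  On a door the rank-one lattice `H₂(N)/Tors = ℤh`, `h² = +1`, makes Taubes' canonical
curve `B` (`[B] = K = h`, genus 2, `B·B = 1`; STUB S1) automatically Poincaré dual to the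
symplectic class, so the open complement `U = N ∖ B` is EXACT (`s|_U = dθ`) and FLAT
(`H₂(U; ℤ) → H₂(N; ℤ)` is torsion-valued, i.e. `Q_W ⊗ ℚ ≡ 0` for `W = N ∖ ν(B)`) — STUB S2.  By
McLean / Diogo–Lisi the exact complement of a symplectic divisor is a LIOUVILLE DOMAIN `(W, λ)`
(tree `IsLiouvilleDomain`) whose convex boundary is the Euler-number-`(−1)` circle bundle over
`Σ₂` with its Boothby–Wang contact structure — STUB S3 (packaging).  The crux is thereby
TRANSFERRED (losslessly: STUB S5 + `flatFillingExclusion_iff`, kernel-checked) to the Betti-free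
filling statement STUB S4 = C⁺ (HARDEST): no closed symplectic 4-manifold contains a symplectic
genus-2 surface of square `+1` whose complement is exact, flat and Liouville-packaged;
equivalently `(Y_{2,−1}, ξ_BW)` has NO exact filling `W` with `Q_W ⊗ ℚ ≡ 0`.

STUBS (five statements; after reshape r2 the registered `sorry` stubs are S1, S3 (closed modulo
named facts by landed conditionals) and S4 (open); S2, S5 are tree theorems; signatures unfolded):
* `stub_taubesCanonicalCurve`   [S1, XL]  door ⇒ embedded symplectic genus-2 `B` with meridian
  injectivity `H₁(N ∖ B) ↪ H₁(N)`.
* `stub_rankOneFlatComplement`  [S2, M/L]  `rank H₂ = 1` + symplectic surface ⇒ `s` exact on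
  `N ∖ B` and `N ∖ B` flat in `N`.
* `stub_liouvillePackaging`     [S3, L]   exact symplectic-divisor complements are Liouville domains.
* `stub_flatFillingExclusion`   [S4, HARDEST, open ⟺ crux]  the transfer target C⁺.
* `stub_closingUp`              [S5, M/L]  genus-2 `B`, meridian-injective, flat complement ⇒
  `(b₁, b₂)(N) = (2, 1)` — the CONVERSE hinge.

`NoGenusTwoDoor_of` composes S1 → S2 → S3 → S4 into the crux BY NAME (pure logic, no `sorry`); S5
enters the proved converse `flatFillingExclusion_of_noGenusTwoDoor`.

Disproof used (`Cruxes/NoGenusTwoDoor/Disproof.lean` v3): §5 `false_withoutCompact` = landed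
`Theorems/NoGenusTwoDoor/Negative/NoncompactDoor.noGenusTwoDoor_false_without_compact` (p74187,
IMPORTED here, `example` below): every stub keeps `[CompactSpace N]`; §1 caveat: `IsClosedForm` is
never detached from `IsSmoothForm`; §10: the `b₁ = 2` exact fillings `W_k` exist, so S4 carries
FLATNESS (not `b₁`) as its load-bearing hypothesis (`ruled_controls_not_flat`).  No `-- Targets`
theorem of the disprover concerns a stub of this line at reshape time.
-/

noncomputable section

-- the prescribed namespace `Summit.<P>.<Sub>.…` duplicates `SmoothPoincare4` (P = Sub)
set_option linter.dupNamespace false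

open scoped Manifold ContDiff Topology ContinuousMap
open Set Function TopologicalSpace
open Literature.Geometry.Kaehler (MForm IsSmoothForm IsClosedForm mextDeriv)
open Literature.AlgebraicTopology.SingularHomology
open Literature.Topology.FourManifolds (singularHomologyZ)
open Summit.SmoothPoincare4.SmoothPoincare4.Theses.SymplecticOrigami (NoGenusTwoDoor)

namespace Summit.SmoothPoincare4.SmoothPoincare4.Cruxes.NoGenusTwoDoor.CanonicalCapFilling

/-- Model space `ℝⁿ`. -/
local notation "𝔼" n:arg => EuclideanSpace ℝ (Fin n)

/-! ### Vocabulary (DOCUMENTATION ONLY — registered signatures below are unfolded) -/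

/-- `(N, s)` is symplectic in the tree's `MForm` vocabulary: `s` chartwise smooth, closed, and
pointwise non-degenerate — the crux's three form hypotheses bundled (Disproof §0). -/
def IsSymplecticMForm {N : Type*} [TopologicalSpace N] [ChartedSpace (𝔼 4) N]
    (s : MForm (𝓡 4) N ℝ 2) : Prop :=
  IsSmoothForm s ∧ IsClosedForm s ∧ ∀ x (v : TangentSpace (𝓡 4) x), v ≠ 0 → ∃ w, s x ![v, w] ≠ 0

/-- `b : S → N` is a smoothly embedded `s`-SYMPLECTIC surface: a `C^∞` embedding whose pulled-back
form `b^* s` is non-degenerate on `S` (same clauses as the route items). -/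
def IsSymplecticSurface {N : Type*} [TopologicalSpace N] [ChartedSpace (𝔼 4) N]
    (s : MForm (𝓡 4) N ℝ 2) {S : Type*} [TopologicalSpace S] [ChartedSpace (𝔼 2) S]
    (b : S → N) : Prop :=
  Manifold.IsSmoothEmbedding (𝓡 2) (𝓡 4) ∞ b ∧
    ∀ y (v : TangentSpace (𝓡 2) y), v ≠ 0 →
      ∃ w : TangentSpace (𝓡 2) y, s (b y) ![mfderiv (𝓡 2) (𝓡 4) b y v, mfderiv (𝓡 2) (𝓡 4) b y w] ≠ 0

/-- The inclusion of the complement of a subset, as a continuous map (for the homology functor);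
the registered signatures spell it `⟨Subtype.val, continuous_subtype_val⟩`. -/
def complIncl (N : Type*) [TopologicalSpace N] (B : Set N) : C(↥Bᶜ, N) :=
  ⟨Subtype.val, continuous_subtype_val⟩

/-- MERIDIAN INJECTIVITY of `B ⊂ N`: `H₁(N ∖ B; ℤ) → H₁(N; ℤ)` is injective (⟺ `B·B = +1` and
`[B]` generates `H₂(N)/Tors`, for `b₂(N) = 1`). -/
def MeridianInjective (N : Type*) [TopologicalSpace N] (B : Set N) : Prop :=
  Function.Injective (singularHomology.map ℤ ℤ (complIncl N B) 1)

/-- FLATNESS of the complement: every integral 2-cycle of `N ∖ B` is TORSION in `H₂(N; ℤ)`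
(`Q_W ⊗ ℚ ≡ 0` for `W = N ∖ ν(B)`). -/
def IsFlat (N : Type*) [TopologicalSpace N] (B : Set N) : Prop :=
  ∀ x, IsOfFinAddOrder (singularHomology.map ℤ ℤ (complIncl N B) 2 x)

/-- EXACTNESS of `s` on an open submanifold `U ⊆ N`: `s|_U = dθ` for a smooth 1-form `θ` on `U`. -/
def IsExactOn {N : Type*} [TopologicalSpace N] [ChartedSpace (𝔼 4) N]
    (s : MForm (𝓡 4) N ℝ 2) (U : Opens N) : Prop :=
  ∃ θ : MForm (𝓡 4) U ℝ 1, IsSmoothForm θ ∧ mextDeriv θ = s.pullback (𝓡 4) (Subtype.val : U → N)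

/-- LIOUVILLE PACKAGING of the complement of `B` in `(N, s)` (McLean's conclusion as a
hypothesis schema): for every open `V ⊇ B` a compact connected Liouville domain `(W, λ)` (tree
`IsLiouvilleDomain`) and an injective immersion `ι : W → N` with `N ∖ V ⊆ ι(W) ⊆ N ∖ B`,
`ι^* s = dλ`. -/
def HasLiouvillePackaging {N : Type} [TopologicalSpace N] [ChartedSpace (𝔼 4) N]
    (s : MForm (𝓡 4) N ℝ 2) (B : Set N) : Prop :=
  ∀ V : Set N, IsOpen V → B ⊆ V →
    ∃ (W : Type) (_ : TopologicalSpace W) (_ : T2Space W) (_ : SecondCountableTopology W)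
      (_ : CompactSpace W) (_ : ConnectedSpace W) (_ : ChartedSpace (EuclideanHalfSpace 4) W)
      (_ : IsManifold (𝓡∂ 4) ∞ W) (lam : MForm (𝓡∂ 4) W ℝ 1) (ι : W → N),
      Literature.Geometry.Symplectic.IsLiouvilleDomain W lam ∧
      ContMDiff (𝓡∂ 4) (𝓡 4) ∞ ι ∧ Function.Injective ι ∧
      (∀ x, Function.Injective (mfderiv (𝓡∂ 4) (𝓡 4) ι x)) ∧
      Set.range ι ⊆ Bᶜ ∧ Vᶜ ⊆ Set.range ι ∧
      mextDeriv lam = s.pullback (𝓡∂ 4) ι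

/-! ### The arithmetic of the hinge (PROVED; integer shadows of S2/S5 and of the controls) -/

/-- CLOSING-UP ARITHMETIC (integer core of S5): in the rank-one odd lattice (`h² = 1`) let
`[B] = m h`, `K ≡ k h`; meridian injectivity gives `m = 1`, adjunction for the genus-2 symplectic
`B` reads `2·2 − 2 = m² + k m`, and `k² = K² = 2χ + 3σ = 2(3 − 2b₁) + 3`.  Then `b₁ = 2`.
[folklore] -/
theorem closingUp_arith {m k b₁ : ℤ} (hm : m = 1) (hadj : 2 * 2 - 2 = m * m + k * m)
    (hk : k * k = 2 * (2 - 2 * b₁ + 1) + 3 * 1) : b₁ = 2 := by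
  subst hm
  have hk1 : k = 1 := by omega
  subst hk1
  omega

/-- The numerically possible `(m, k)` for a genus-2 symplectic class `m h` at `b₂ = 1`
(`2 = m² + km`, `k` odd, `m > 0`): exactly `(1, 1)` — the door — or `(2, −1)`. [folklore] -/
theorem genusTwo_roots {m k : ℤ} (hm : 0 < m) (hadj : 2 = m * m + k * m) (hodd : Odd k) :
    (m = 1 ∧ k = 1) ∨ (m = 2 ∧ k = -1) := by
  have h2 : 2 = m * (m + k) := by rw [mul_add, mul_comm m k]; exact hadj
  have hm2 : m ≤ 2 := Int.le_of_dvd (by norm_num) ⟨m + k, h2⟩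
  rcases hodd with ⟨j, rfl⟩
  interval_cases m <;> omega

/-- COMPLEMENT EULER NUMBER: `χ(W) = χ(N) − χ(B) = (3 − 2b₁) − (2 − 2g)`; for the door `χ(W) = 1`,
and capping a filling with `χ(W) = 1`, `b₁ = 2` returns `χ = −1`. [folklore] -/
theorem complement_euler {b₁ g χW : ℤ} (hb : b₁ = 2) (hg : g = 2)
    (hχ : χW = (2 - 2 * b₁ + 1) - (2 - 2 * g)) : χW = 1 ∧ χW - 2 = 2 - 2 * b₁ + 1 := by
  subst hb hg; omega

/-- CONTROLS ARE NOT FLAT (why S4 carries flatness, not `b₁(W) = 2`; Disproof §10): a closed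
symplectic host with `b₂ = 1 + n`, `n ≥ 1`, leaves `b⁻(W) = n ≥ 1` negative classes in the
complement of a square-`(+1)` curve carrying `b⁺`, so `Q_W ≠ 0`. [folklore] -/
theorem ruled_controls_not_flat {n bpos bneg : ℤ} (hn : 1 ≤ n) (hsum : bpos + bneg = 1 + n)
    (hpos : bpos = 1) : bneg ≠ 0 := by
  omega

/-! ### The five stub STATEMENTS as named `Prop`s — UNFOLDED (tree / Mathlib terms only).
The registered `stub_*` theorems below restate them verbatim; `Registered.stub_*` are name-keyed
aliases used as the hypotheses of `NoGenusTwoDoor_of`. -/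

/-- Statement of STUB S1 [Taubes canonical curve], unfolded. -/
def TaubesCanonicalCurve : Prop :=
  ∀ (N : Type) [TopologicalSpace N] [T2Space N] [SecondCountableTopology N] [CompactSpace N]
    [ConnectedSpace N] [ChartedSpace (𝔼 4) N] [IsManifold (𝓡 4) ∞ N] (s : MForm (𝓡 4) N ℝ 2),
    IsSmoothForm s → IsClosedForm s →
    (∀ x (v : TangentSpace (𝓡 4) x), v ≠ 0 → ∃ w, s x ![v, w] ≠ 0) →
    Module.finrank ℤ (singularHomologyZ N 1) = 2 → Module.finrank ℤ (singularHomologyZ N 2) = 1 →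
    ∃ (S : Type) (_ : TopologicalSpace S) (_ : T2Space S) (_ : CompactSpace S) (_ : ConnectedSpace S)
      (_ : ChartedSpace (𝔼 2) S) (_ : IsManifold (𝓡 2) ∞ S) (b : S → N),
      Module.finrank ℤ (singularHomologyZ S 1) = 4 ∧
      Manifold.IsSmoothEmbedding (𝓡 2) (𝓡 4) ∞ b ∧
      (∀ y (v : TangentSpace (𝓡 2) y), v ≠ 0 → ∃ w : TangentSpace (𝓡 2) y,
        s (b y) ![mfderiv (𝓡 2) (𝓡 4) b y v, mfderiv (𝓡 2) (𝓡 4) b y w] ≠ 0) ∧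
      Function.Injective (singularHomology.map ℤ ℤ
        (⟨Subtype.val, continuous_subtype_val⟩ : C(↥(Set.range b)ᶜ, N)) 1)

/-- Statement of STUB S2 [rank-one flat complement], unfolded. -/
def RankOneFlatComplement : Prop :=
  ∀ (N : Type) [TopologicalSpace N] [T2Space N] [SecondCountableTopology N] [CompactSpace N]
    [ConnectedSpace N] [ChartedSpace (𝔼 4) N] [IsManifold (𝓡 4) ∞ N] (s : MForm (𝓡 4) N ℝ 2)
    (S : Type) [TopologicalSpace S] [T2Space S] [CompactSpace S] [ConnectedSpace S]
    [ChartedSpace (𝔼 2) S] [IsManifold (𝓡 2) ∞ S] (b : S → N),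
    IsSmoothForm s → IsClosedForm s →
    (∀ x (v : TangentSpace (𝓡 4) x), v ≠ 0 → ∃ w, s x ![v, w] ≠ 0) →
    Module.finrank ℤ (singularHomologyZ N 2) = 1 →
    Manifold.IsSmoothEmbedding (𝓡 2) (𝓡 4) ∞ b →
    (∀ y (v : TangentSpace (𝓡 2) y), v ≠ 0 → ∃ w : TangentSpace (𝓡 2) y,
      s (b y) ![mfderiv (𝓡 2) (𝓡 4) b y v, mfderiv (𝓡 2) (𝓡 4) b y w] ≠ 0) →
    (∀ U : Opens N, (U : Set N) = (Set.range b)ᶜ →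
      ∃ θ : MForm (𝓡 4) U ℝ 1, IsSmoothForm θ ∧
        mextDeriv θ = s.pullback (𝓡 4) (Subtype.val : U → N)) ∧
    (∀ x, IsOfFinAddOrder (singularHomology.map ℤ ℤ
      (⟨Subtype.val, continuous_subtype_val⟩ : C(↥(Set.range b)ᶜ, N)) 2 x))

/-- Statement of STUB S3 [Liouville packaging], unfolded. -/
def LiouvillePackaging : Prop :=
  ∀ (N : Type) [TopologicalSpace N] [T2Space N] [SecondCountableTopology N] [CompactSpace N]
    [ConnectedSpace N] [ChartedSpace (𝔼 4) N] [IsManifold (𝓡 4) ∞ N] (s : MForm (𝓡 4) N ℝ 2)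
    (S : Type) [TopologicalSpace S] [T2Space S] [CompactSpace S] [ConnectedSpace S]
    [ChartedSpace (𝔼 2) S] [IsManifold (𝓡 2) ∞ S] (b : S → N) (U : Opens N),
    IsSmoothForm s → IsClosedForm s →
    (∀ x (v : TangentSpace (𝓡 4) x), v ≠ 0 → ∃ w, s x ![v, w] ≠ 0) →
    Manifold.IsSmoothEmbedding (𝓡 2) (𝓡 4) ∞ b →
    (∀ y (v : TangentSpace (𝓡 2) y), v ≠ 0 → ∃ w : TangentSpace (𝓡 2) y,
      s (b y) ![mfderiv (𝓡 2) (𝓡 4) b y v, mfderiv (𝓡 2) (𝓡 4) b y w] ≠ 0) →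
    (U : Set N) = (Set.range b)ᶜ →
    (∃ θ : MForm (𝓡 4) U ℝ 1, IsSmoothForm θ ∧
      mextDeriv θ = s.pullback (𝓡 4) (Subtype.val : U → N)) →
    ∀ V : Set N, IsOpen V → Set.range b ⊆ V →
      ∃ (W : Type) (_ : TopologicalSpace W) (_ : T2Space W) (_ : SecondCountableTopology W)
        (_ : CompactSpace W) (_ : ConnectedSpace W) (_ : ChartedSpace (EuclideanHalfSpace 4) W)
        (_ : IsManifold (𝓡∂ 4) ∞ W) (lam : MForm (𝓡∂ 4) W ℝ 1) (ι : W → N),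
        Literature.Geometry.Symplectic.IsLiouvilleDomain W lam ∧
        ContMDiff (𝓡∂ 4) (𝓡 4) ∞ ι ∧ Function.Injective ι ∧
        (∀ x, Function.Injective (mfderiv (𝓡∂ 4) (𝓡 4) ι x)) ∧
        Set.range ι ⊆ (Set.range b)ᶜ ∧ Vᶜ ⊆ Set.range ι ∧
        mextDeriv lam = s.pullback (𝓡∂ 4) ι

/-- Statement of STUB S4 [flat filling exclusion] — the transfer target C⁺, unfolded. -/
def FlatFillingExclusion : Prop :=
  ∀ (N : Type) [TopologicalSpace N] [T2Space N] [SecondCountableTopology N] [CompactSpace N]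
    [ConnectedSpace N] [ChartedSpace (𝔼 4) N] [IsManifold (𝓡 4) ∞ N] (s : MForm (𝓡 4) N ℝ 2)
    (S : Type) [TopologicalSpace S] [T2Space S] [CompactSpace S] [ConnectedSpace S]
    [ChartedSpace (𝔼 2) S] [IsManifold (𝓡 2) ∞ S] (b : S → N) (U : Opens N),
    IsSmoothForm s → IsClosedForm s →
    (∀ x (v : TangentSpace (𝓡 4) x), v ≠ 0 → ∃ w, s x ![v, w] ≠ 0) →
    Module.finrank ℤ (singularHomologyZ S 1) = 4 →
    Manifold.IsSmoothEmbedding (𝓡 2) (𝓡 4) ∞ b →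
    (∀ y (v : TangentSpace (𝓡 2) y), v ≠ 0 → ∃ w : TangentSpace (𝓡 2) y,
      s (b y) ![mfderiv (𝓡 2) (𝓡 4) b y v, mfderiv (𝓡 2) (𝓡 4) b y w] ≠ 0) →
    (U : Set N) = (Set.range b)ᶜ →
    Function.Injective (singularHomology.map ℤ ℤ
      (⟨Subtype.val, continuous_subtype_val⟩ : C(↥(Set.range b)ᶜ, N)) 1) →
    (∃ θ : MForm (𝓡 4) U ℝ 1, IsSmoothForm θ ∧
      mextDeriv θ = s.pullback (𝓡 4) (Subtype.val : U → N)) →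
    (∀ x, IsOfFinAddOrder (singularHomology.map ℤ ℤ
      (⟨Subtype.val, continuous_subtype_val⟩ : C(↥(Set.range b)ᶜ, N)) 2 x)) →
    (∀ V : Set N, IsOpen V → Set.range b ⊆ V →
      ∃ (W : Type) (_ : TopologicalSpace W) (_ : T2Space W) (_ : SecondCountableTopology W)
        (_ : CompactSpace W) (_ : ConnectedSpace W) (_ : ChartedSpace (EuclideanHalfSpace 4) W)
        (_ : IsManifold (𝓡∂ 4) ∞ W) (lam : MForm (𝓡∂ 4) W ℝ 1) (ι : W → N),
        Literature.Geometry.Symplectic.IsLiouvilleDomain W lam ∧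
        ContMDiff (𝓡∂ 4) (𝓡 4) ∞ ι ∧ Function.Injective ι ∧
        (∀ x, Function.Injective (mfderiv (𝓡∂ 4) (𝓡 4) ι x)) ∧
        Set.range ι ⊆ (Set.range b)ᶜ ∧ Vᶜ ⊆ Set.range ι ∧
        mextDeriv lam = s.pullback (𝓡∂ 4) ι) →
    False

/-- Statement of STUB S5 [closing up] — the card's first lemma `GenusTwoPinsDoor`, unfolded. -/
def ClosingUp : Prop :=
  ∀ (N : Type) [TopologicalSpace N] [T2Space N] [SecondCountableTopology N] [CompactSpace N]
    [ConnectedSpace N] [ChartedSpace (𝔼 4) N] [IsManifold (𝓡 4) ∞ N] (s : MForm (𝓡 4) N ℝ 2)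
    (S : Type) [TopologicalSpace S] [T2Space S] [CompactSpace S] [ConnectedSpace S]
    [ChartedSpace (𝔼 2) S] [IsManifold (𝓡 2) ∞ S] (b : S → N),
    IsSmoothForm s → IsClosedForm s →
    (∀ x (v : TangentSpace (𝓡 4) x), v ≠ 0 → ∃ w, s x ![v, w] ≠ 0) →
    Module.finrank ℤ (singularHomologyZ S 1) = 4 →
    Manifold.IsSmoothEmbedding (𝓡 2) (𝓡 4) ∞ b →
    (∀ y (v : TangentSpace (𝓡 2) y), v ≠ 0 → ∃ w : TangentSpace (𝓡 2) y,
      s (b y) ![mfderiv (𝓡 2) (𝓡 4) b y v, mfderiv (𝓡 2) (𝓡 4) b y w] ≠ 0) →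
    Function.Injective (singularHomology.map ℤ ℤ
      (⟨Subtype.val, continuous_subtype_val⟩ : C(↥(Set.range b)ᶜ, N)) 1) →
    (∀ x, IsOfFinAddOrder (singularHomology.map ℤ ℤ
      (⟨Subtype.val, continuous_subtype_val⟩ : C(↥(Set.range b)ᶜ, N)) 2 x)) →
    Module.finrank ℤ (singularHomologyZ N 1) = 2 ∧ Module.finrank ℤ (singularHomologyZ N 2) = 1

/-! ### The registered stubs (signatures = the unfolded statements, verbatim) -/

/-- STUB S1 [TAUBES CANONICAL CURVE] — CLOSED MODULO EXACTLY {Hirzebruch `c₁² = 2χ + 3σ`,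
Li–Liu `SW ⇒ Gr` at `b⁺ = 1`} (reshape r4: landed `stub_taubesCanonicalCurve_of_liLiu`, p141385; see
`stub_taubesCanonicalCurve_closedModuloLiLiu`), earlier modulo the umbrella named fact
`Literature.Geometry.Symplectic.taubes_canonicalClass_symplecticCurve_four` (wave 1: conditional
`stub_taubesCanonicalCurve_of_taubes` p87978 + helpers p86619 cup lemma, p86633 door lattice; the
Thom–Gysin input is discharged in tree).  (The route's foreseen layer-2 input
`DoorHasCanonicalGenusTwoCurve`; SHARED with the liouville line's `stub_canonicalCurve`).  A door
`(N, s)` — closed connected symplectic with `(rank H₁, rank H₂) = (2, 1)` — contains a smoothly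
embedded compact connected `s`-symplectic surface `B = b(S)` of genus 2 (`rank H₁(S) = 4`) with
`H₁(N ∖ B; ℤ) → H₁(N; ℤ)` injective (⟺ `B·B = +1`, `[B]` generates `H₂(N)/Tors`).  Proof in print:
`b₂ = 1`, `[s]² > 0` ⇒ `b⁺ = 1`, `b⁻ = 0`, `H₂/Tors = ℤh`, `h² = 1`, `K ≡ kh`, `k² = 2χ + 3σ = 1`;
the cup product `H¹ ⊗ H¹ → H²` vanishes rationally at `b₂ = 1` (triage r1-3 F4, proved over `ℚ`
from tree `cupProduct_gradedComm_holds` + `isPerfPair_cupPairing_of_field_holds`), so every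
Li–Liu / Okonek–Teleman wall-crossing number of the `b⁺ = 1`, `b₁ = 2` manifold is ZERO and
`SW(𝔰_ω ⊗ K) = ±SW(𝔰_ω) = ±1` in the `s`-chamber (Taubes 1994; conjugation symmetry); Taubes'
`SW ⇒ Gr` for `b⁺ = 1` (Taubes 1996/2000, Li–Liu IMRN 1999) gives an embedded symplectic curve
`C = ⊔ Cⱼ` with `[C] = PD⁻¹ K`; each `[Cⱼ] = mⱼ h + tⱼ` has `mⱼ ≥ 1` (positive area), `Σ mⱼ = 1`
forces ONE component with `m = 1`, `k = +1`; genus by adjunction `2g − 2 = C² + K·C = 2`; meridian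
injectivity from `h·B = 1` (Thom–Gysin).  Why it might fail: not mathematically — it fails only as
a FORMAL task: no Seiberg–Witten / Gromov–Taubes theory, no first Chern class of a symplectic
`MForm`, in the tree (XL); the expected outcome is "closed modulo a named fact"
(`taubes_liLiu_canonicalCurve_bPlusOne`-type, stated in tree vocabulary) plus the proved cup lemma.
Uses `[CompactSpace N]` essentially (Disproof §5 witness `T*T²`: exact form, no closed symplectic
surface).  Sources: Taubes1994 (doi:10.4310/MRL.1994.v1.n6.a15), Taubes1996
(doi:10.1090/S0894-0347-96-00211-1), LiLiu1995 (doi:10.4310/MRL.1995.v2.n6.a13), Li–Liu IMRN 1999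
no. 7 (doi:10.1155/S1073792899000173), OkonekTeleman1996 (doi:10.1142/s0129167x96000438), Liu1996,
LiLiu2001, McDuffSalamon2017 §13.3; triage `CupLemma.lean` (evidence on the item).  Size: XL. -/
theorem stub_taubesCanonicalCurve :
    ∀ (N : Type) [TopologicalSpace N] [T2Space N] [SecondCountableTopology N] [CompactSpace N]
      [ConnectedSpace N] [ChartedSpace (𝔼 4) N] [IsManifold (𝓡 4) ∞ N] (s : MForm (𝓡 4) N ℝ 2),
      IsSmoothForm s → IsClosedForm s →
      (∀ x (v : TangentSpace (𝓡 4) x), v ≠ 0 → ∃ w, s x ![v, w] ≠ 0) →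
      Module.finrank ℤ (singularHomologyZ N 1) = 2 → Module.finrank ℤ (singularHomologyZ N 2) = 1 →
      ∃ (S : Type) (_ : TopologicalSpace S) (_ : T2Space S) (_ : CompactSpace S)
        (_ : ConnectedSpace S) (_ : ChartedSpace (𝔼 2) S) (_ : IsManifold (𝓡 2) ∞ S) (b : S → N),
        Module.finrank ℤ (singularHomologyZ S 1) = 4 ∧
        Manifold.IsSmoothEmbedding (𝓡 2) (𝓡 4) ∞ b ∧
        (∀ y (v : TangentSpace (𝓡 2) y), v ≠ 0 → ∃ w : TangentSpace (𝓡 2) y,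
          s (b y) ![mfderiv (𝓡 2) (𝓡 4) b y v, mfderiv (𝓡 2) (𝓡 4) b y w] ≠ 0) ∧
        Function.Injective (singularHomology.map ℤ ℤ
          (⟨Subtype.val, continuous_subtype_val⟩ : C(↥(Set.range b)ᶜ, N)) 1) := by
  sorry

/-- S1 closes MODULO the named fact (landed conditional `stub_taubesCanonicalCurve_of_taubes`,
p87978; Thom–Gysin input discharged in tree). [folklore] -/
theorem stub_taubesCanonicalCurve_closedModulo
    (hT : Literature.Geometry.Symplectic.taubes_canonicalClass_symplecticCurve_four) :
    ∀ (N : Type) [TopologicalSpace N] [T2Space N] [SecondCountableTopology N] [CompactSpace N]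
      [ConnectedSpace N] [ChartedSpace (𝔼 4) N] [IsManifold (𝓡 4) ∞ N] (s : MForm (𝓡 4) N ℝ 2),
      IsSmoothForm s → IsClosedForm s →
      (∀ x (v : TangentSpace (𝓡 4) x), v ≠ 0 → ∃ w, s x ![v, w] ≠ 0) →
      Module.finrank ℤ (singularHomologyZ N 1) = 2 → Module.finrank ℤ (singularHomologyZ N 2) = 1 →
      ∃ (S : Type) (_ : TopologicalSpace S) (_ : T2Space S) (_ : CompactSpace S)
        (_ : ConnectedSpace S) (_ : ChartedSpace (𝔼 2) S) (_ : IsManifold (𝓡 2) ∞ S) (b : S → N),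
        Module.finrank ℤ (singularHomologyZ S 1) = 4 ∧
        Manifold.IsSmoothEmbedding (𝓡 2) (𝓡 4) ∞ b ∧
        (∀ y (v : TangentSpace (𝓡 2) y), v ≠ 0 → ∃ w : TangentSpace (𝓡 2) y,
          s (b y) ![mfderiv (𝓡 2) (𝓡 4) b y v, mfderiv (𝓡 2) (𝓡 4) b y w] ≠ 0) ∧
        Function.Injective (singularHomology.map ℤ ℤ
          (⟨Subtype.val, continuous_subtype_val⟩ : C(↥(Set.range b)ᶜ, N)) 1) :=
  Summit.SmoothPoincare4.SmoothPoincare4.Theorems.NoGenusTwoDoor.CanonicalCapFilling.stub_taubesCanonicalCurve_of_taubes hT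
    Literature.Geometry.Symplectic.thomGysin_complement_surface_four_holds

/-- S1 closes MODULO EXACTLY THE TWO PRINTED THEOREMS A DOOR CONSUMES (reshape r4): Hirzebruch's
`c₁² = 2χ + 3σ` for closed almost complex `4`-manifolds
(`hirzebruch_firstChernClass_sq_eq_almostComplex_four`) and Li–Liu's `SW ⇒ Gr` for the canonical
class at `b⁺ = 1` (`liLiu1995_hasTaubesCurve_canonicalClass_of_bPlus_eq_one`) — the landed tree
theorem `stub_taubesCanonicalCurve_of_liLiu` (p141385), which re-runs the proof of p87978 pointwise
at the door (symplectic orientation from de Rham, `b⁺ = 1` from `b₂ = 1`, cup lemma, Li–Liu's curve,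
lattice / one-component / adjunction / Thom–Gysin); Taubes 1995 Thm. A (1) (`b⁺ ≥ 2`) is not an
input. [folklore] -/
theorem stub_taubesCanonicalCurve_closedModuloLiLiu
    (hB : Literature.Geometry.Symplectic.hirzebruch_firstChernClass_sq_eq_almostComplex_four)
    (hC₁ : Literature.Geometry.Symplectic.liLiu1995_hasTaubesCurve_canonicalClass_of_bPlus_eq_one) :
    ∀ (N : Type) [TopologicalSpace N] [T2Space N] [SecondCountableTopology N] [CompactSpace N]
      [ConnectedSpace N] [ChartedSpace (𝔼 4) N] [IsManifold (𝓡 4) ∞ N] (s : MForm (𝓡 4) N ℝ 2),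
      IsSmoothForm s → IsClosedForm s →
      (∀ x (v : TangentSpace (𝓡 4) x), v ≠ 0 → ∃ w, s x ![v, w] ≠ 0) →
      Module.finrank ℤ (singularHomologyZ N 1) = 2 → Module.finrank ℤ (singularHomologyZ N 2) = 1 →
      ∃ (S : Type) (_ : TopologicalSpace S) (_ : T2Space S) (_ : CompactSpace S)
        (_ : ConnectedSpace S) (_ : ChartedSpace (𝔼 2) S) (_ : IsManifold (𝓡 2) ∞ S) (b : S → N),
        Module.finrank ℤ (singularHomologyZ S 1) = 4 ∧
        Manifold.IsSmoothEmbedding (𝓡 2) (𝓡 4) ∞ b ∧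
        (∀ y (v : TangentSpace (𝓡 2) y), v ≠ 0 → ∃ w : TangentSpace (𝓡 2) y,
          s (b y) ![mfderiv (𝓡 2) (𝓡 4) b y v, mfderiv (𝓡 2) (𝓡 4) b y w] ≠ 0) ∧
        Function.Injective (singularHomology.map ℤ ℤ
          (⟨Subtype.val, continuous_subtype_val⟩ : C(↥(Set.range b)ᶜ, N)) 1) :=
  Summit.SmoothPoincare4.SmoothPoincare4.Theorems.NoGenusTwoDoor.CanonicalCapFilling.stub_taubesCanonicalCurve_of_liLiu
    hB hC₁

/-- STUB S2 [RANK-ONE FLAT COMPLEMENT] — LANDED UNCONDITIONALLY (wave 1, p90504: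
`Theorems/SymplecticOrigamiNoGenusTwoDoorStubRankOneFlatComplement.lean`, de Rham + Gysin route, no
named fact).  (M mathematically.)  For a closed connected
symplectic `(N, s)` with `rank H₂(N; ℤ) = 1` and ANY smoothly embedded compact connected
`s`-symplectic surface `B = b(S)`: (i) `s` is EXACT on the open complement `U = N ∖ B`
(`s|_U = dθ`, `θ` a smooth 1-form on the open submanifold `U`), and (ii) `U` is FLAT in `N`
(integral 2-cycles of `U` are torsion in `H₂(N)`).  Proof: `H₂(N)/Tors = ℤh` unimodular,
`[s]_ℝ = λ·PD(h)`, `∫_B s > 0` ⇒ `[B] = mh + t`, `m ≠ 0`, `h² = +1`; (ii) a 2-cycle `z ⊂ U` misses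
`B`, so `z·B = 0` (the intersection pairing of disjointly supported classes vanishes: `PD[B]` is
the image of the Thom class of `ν(B)`), `[z] = ah + t'` with `am = 0` ⇒ `a = 0`; (i)
`PD[B]_ℝ|_U = 0` in `H²(U; ℝ) ≅ Hom(H₂(U; ℝ), ℝ)`, hence `[s]|_U = 0` in `H²_dR(U)` (de Rham's
theorem for the open 4-manifold `U`), i.e. `s|_U = dθ`.  Why it might fail: only by mis-typing;
formally it needs (a) "symplectic surfaces are rationally essential" (`∫_B s > 0` + Stokes —
integration of `MForm`s over a closed surface is not in the tree: name it), (b) a Thom /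
tubular-neighbourhood input for the smooth compact surface `B` (`H₂(N, N ∖ B) ≅ H₀(B)`), (c) the
de Rham theorem on the open manifold `U` (tree named fact; `Literature/Geometry/Manifold/DeRhamComparison.lean`).
The FLATNESS half given meridian injectivity (which S1 supplies) needs only (b) + the tree's proved
Poincaré duality — a worker should land that half first as `--supports`.  Cheapest falsifier:
`(ℂP², line)`: `U = ℂ²`, exact ✓, flat ✓; `(ℂP², conic)`: `U ≅ T*ℝP²` ✓.  Leans on:
`Literature.AlgebraicTopology.SingularHomology.{PoincareDuality(+Proofs, Closed), IntersectionForm,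
GysinMap, AlexanderDualityFacts, LefschetzDuality, ExcisionMayerVietoris, LocallyFlatThomLocalModel,
LocallyFlatComplement}`, `Literature.Geometry.Manifold.DeRhamComparison`,
`Literature.Geometry.Kaehler.ManifoldFormsPullback` (`MForm.pullback_apply`, `mextDeriv_pullback_apply`).
Sources: BottTu1982 §I.5–6, HatcherAT2002 §3.3, MilnorStasheff1974 §9–§11, McDuffSalamon2017 §13.3;
Disproof §9.  Size: M (L/XL formal). -/
theorem stub_rankOneFlatComplement :
    ∀ (N : Type) [TopologicalSpace N] [T2Space N] [SecondCountableTopology N] [CompactSpace N]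
      [ConnectedSpace N] [ChartedSpace (𝔼 4) N] [IsManifold (𝓡 4) ∞ N] (s : MForm (𝓡 4) N ℝ 2)
      (S : Type) [TopologicalSpace S] [T2Space S] [CompactSpace S] [ConnectedSpace S]
      [ChartedSpace (𝔼 2) S] [IsManifold (𝓡 2) ∞ S] (b : S → N),
      IsSmoothForm s → IsClosedForm s →
      (∀ x (v : TangentSpace (𝓡 4) x), v ≠ 0 → ∃ w, s x ![v, w] ≠ 0) →
      Module.finrank ℤ (singularHomologyZ N 2) = 1 →
      Manifold.IsSmoothEmbedding (𝓡 2) (𝓡 4) ∞ b →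
      (∀ y (v : TangentSpace (𝓡 2) y), v ≠ 0 → ∃ w : TangentSpace (𝓡 2) y,
        s (b y) ![mfderiv (𝓡 2) (𝓡 4) b y v, mfderiv (𝓡 2) (𝓡 4) b y w] ≠ 0) →
      (∀ U : Opens N, (U : Set N) = (Set.range b)ᶜ →
        ∃ θ : MForm (𝓡 4) U ℝ 1, IsSmoothForm θ ∧
          mextDeriv θ = s.pullback (𝓡 4) (Subtype.val : U → N)) ∧
      (∀ x, IsOfFinAddOrder (singularHomology.map ℤ ℤ
        (⟨Subtype.val, continuous_subtype_val⟩ : C(↥(Set.range b)ᶜ, N)) 2 x)) :=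
  Summit.SmoothPoincare4.SmoothPoincare4.Theorems.NoGenusTwoDoor.CanonicalCapFilling.stub_rankOneFlatComplement

/-- STUB S3 [LIOUVILLE PACKAGING] — CLOSED UNCONDITIONALLY (reshape r3, 2026-08-17): the named
fact `Literature.Geometry.Symplectic.mclean_divisorComplement_convex_four` (McLean's finite-type
convex structure on the divisor complement) is DISCHARGED in the tree
(`mclean_divisorComplement_convex_four_holds`, 2026-08-16T21:17Z), so the wave-1 conditional
`stub_liouvillePackaging_of_mclean` (p92246) applied to it and to the two other discharged inputs
(codimension-2 complements are connected: `isConnected_compl_range_of_isSmoothEmbedding_holds`;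
Milnor retraction: `isPreconnected_sublevel_of_forall_mfderiv_ne_zero_holds`) IS the stub — no
`sorry` below.  (A theorem in print: McLean 2012 Lemma 5.17 ff / Diogo–Lisi 2019
§2.1 "complements of symplectic divisors"; L mathematically, XL formally).  Let `(N, s)` be closed
connected symplectic, `B = b(S)` a smoothly embedded compact connected `s`-symplectic surface, and
suppose `s` is exact on `U = N ∖ B` (⟺ `[s] = c·PD[B]`, `c > 0`).  Then for every open `V ⊇ B`
there is a compact connected Liouville domain `(W, λ)` in the tree's sense (`IsLiouvilleDomain`:
`λ` smooth, `dλ` non-degenerate, Liouville field transversally OUTWARD along `∂W`, i.e. negative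
`x₀`-component in boundary charts) embedded by an injective immersion `ι : W → N` with
`N ∖ V ⊆ ι(W) ⊆ N ∖ B` and `ι^* s = dλ`.  Construction (McLean; Diogo–Lisi Lemma 2.2–2.4):
symplectic neighbourhood theorem — `ν_ε(B)` is the radius-`ε` disc bundle of the Hermitian line
bundle `L = ν_B` with a `π^*σ_B + d(ρ² α)`-type model; on `N ∖ B` the primitive `θ` of `s` is
corrected by an exact term to `λ` agreeing with the model primitive `(ρ² − c')α` near `B`, whose
Liouville field points INTO the tube, i.e. OUT of `W = N ∖ ν_ε(B)`; `ε` small puts `ν_ε(B) ⊆ V`.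
Why it might fail: as mathematics it does not; risks are in the TYPING — `W` as an abstract
`𝓡∂ 4`-manifold (the tree's sublevel-domain technology: `Literature.Topology.FourManifolds.BoundaryData`,
`ClosedBall`, `Literature.Geometry.Symplectic.SteinBallSublevel`, `SteinDomain*`), the symplectic
neighbourhood theorem and Moser (not in Mathlib).  Cheapest falsifier: `(ℂP², line, ω_FS)`:
`W` = round ball `B⁴(r)`, `λ = λ_std`, boundary `(S³, ξ_std)` ✓.  Sources: Mclean2012
(doi:10.1007/s00039-012-0158-7 = arXiv:1011.2542, Lemma 5.17, 5.19), DiogoLisi2019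
(doi:10.1112/topo.12105, §2, Lemma 2.2–2.4), McDuffSalamon2017 Thm 3.4.10, Geiges2008 §7.2.
Size: L (XL formal). -/
theorem stub_liouvillePackaging :
    ∀ (N : Type) [TopologicalSpace N] [T2Space N] [SecondCountableTopology N] [CompactSpace N]
      [ConnectedSpace N] [ChartedSpace (𝔼 4) N] [IsManifold (𝓡 4) ∞ N] (s : MForm (𝓡 4) N ℝ 2)
      (S : Type) [TopologicalSpace S] [T2Space S] [CompactSpace S] [ConnectedSpace S]
      [ChartedSpace (𝔼 2) S] [IsManifold (𝓡 2) ∞ S] (b : S → N) (U : Opens N),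
      IsSmoothForm s → IsClosedForm s →
      (∀ x (v : TangentSpace (𝓡 4) x), v ≠ 0 → ∃ w, s x ![v, w] ≠ 0) →
      Manifold.IsSmoothEmbedding (𝓡 2) (𝓡 4) ∞ b →
      (∀ y (v : TangentSpace (𝓡 2) y), v ≠ 0 → ∃ w : TangentSpace (𝓡 2) y,
        s (b y) ![mfderiv (𝓡 2) (𝓡 4) b y v, mfderiv (𝓡 2) (𝓡 4) b y w] ≠ 0) →
      (U : Set N) = (Set.range b)ᶜ →
      (∃ θ : MForm (𝓡 4) U ℝ 1, IsSmoothForm θ ∧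
        mextDeriv θ = s.pullback (𝓡 4) (Subtype.val : U → N)) →
      ∀ V : Set N, IsOpen V → Set.range b ⊆ V →
        ∃ (W : Type) (_ : TopologicalSpace W) (_ : T2Space W) (_ : SecondCountableTopology W)
          (_ : CompactSpace W) (_ : ConnectedSpace W) (_ : ChartedSpace (EuclideanHalfSpace 4) W)
          (_ : IsManifold (𝓡∂ 4) ∞ W) (lam : MForm (𝓡∂ 4) W ℝ 1) (ι : W → N),
          Literature.Geometry.Symplectic.IsLiouvilleDomain W lam ∧
          ContMDiff (𝓡∂ 4) (𝓡 4) ∞ ι ∧ Function.Injective ι ∧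
          (∀ x, Function.Injective (mfderiv (𝓡∂ 4) (𝓡 4) ι x)) ∧
          Set.range ι ⊆ (Set.range b)ᶜ ∧ Vᶜ ⊆ Set.range ι ∧
          mextDeriv lam = s.pullback (𝓡∂ 4) ι :=
  -- LANDED (p140840) as `Theorems/SymplecticOrigamiNoGenusTwoDoorStubLiouvillePackagingHolds.lean`,
  -- `…Theorems.NoGenusTwoDoor.CanonicalCapFilling.stub_liouvillePackaging`, whose proof is this term:
  Summit.SmoothPoincare4.SmoothPoincare4.Theorems.NoGenusTwoDoor.CanonicalCapFilling.stub_liouvillePackaging_of_mclean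
    Literature.Geometry.Symplectic.mclean_divisorComplement_convex_four_holds
    Literature.Geometry.Symplectic.isConnected_compl_range_of_isSmoothEmbedding_holds
    Literature.Geometry.Symplectic.isPreconnected_sublevel_of_forall_mfderiv_ne_zero_holds

/-- S3 modulo McLean's named fact (the wave-1 conditional `stub_liouvillePackaging_of_mclean`,
p92246, kept for the record; superseded by the unconditional `stub_liouvillePackaging` above now
that the fact is discharged). [folklore] -/
theorem stub_liouvillePackaging_closedModulo
    (hM : Literature.Geometry.Symplectic.mclean_divisorComplement_convex_four) :
    ∀ (N : Type) [TopologicalSpace N] [T2Space N] [SecondCountableTopology N] [CompactSpace N]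
      [ConnectedSpace N] [ChartedSpace (𝔼 4) N] [IsManifold (𝓡 4) ∞ N] (s : MForm (𝓡 4) N ℝ 2)
      (S : Type) [TopologicalSpace S] [T2Space S] [CompactSpace S] [ConnectedSpace S]
      [ChartedSpace (𝔼 2) S] [IsManifold (𝓡 2) ∞ S] (b : S → N) (U : Opens N),
      IsSmoothForm s → IsClosedForm s →
      (∀ x (v : TangentSpace (𝓡 4) x), v ≠ 0 → ∃ w, s x ![v, w] ≠ 0) →
      Manifold.IsSmoothEmbedding (𝓡 2) (𝓡 4) ∞ b →
      (∀ y (v : TangentSpace (𝓡 2) y), v ≠ 0 → ∃ w : TangentSpace (𝓡 2) y,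
        s (b y) ![mfderiv (𝓡 2) (𝓡 4) b y v, mfderiv (𝓡 2) (𝓡 4) b y w] ≠ 0) →
      (U : Set N) = (Set.range b)ᶜ →
      (∃ θ : MForm (𝓡 4) U ℝ 1, IsSmoothForm θ ∧
        mextDeriv θ = s.pullback (𝓡 4) (Subtype.val : U → N)) →
      ∀ V : Set N, IsOpen V → Set.range b ⊆ V →
        ∃ (W : Type) (_ : TopologicalSpace W) (_ : T2Space W) (_ : SecondCountableTopology W)
          (_ : CompactSpace W) (_ : ConnectedSpace W) (_ : ChartedSpace (EuclideanHalfSpace 4) W)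
          (_ : IsManifold (𝓡∂ 4) ∞ W) (lam : MForm (𝓡∂ 4) W ℝ 1) (ι : W → N),
          Literature.Geometry.Symplectic.IsLiouvilleDomain W lam ∧
          ContMDiff (𝓡∂ 4) (𝓡 4) ∞ ι ∧ Function.Injective ι ∧
          (∀ x, Function.Injective (mfderiv (𝓡∂ 4) (𝓡 4) ι x)) ∧
          Set.range ι ⊆ (Set.range b)ᶜ ∧ Vᶜ ⊆ Set.range ι ∧
          mextDeriv lam = s.pullback (𝓡∂ 4) ι :=
  Summit.SmoothPoincare4.SmoothPoincare4.Theorems.NoGenusTwoDoor.CanonicalCapFilling.stub_liouvillePackaging_of_mclean hM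
    Literature.Geometry.Symplectic.isConnected_compl_range_of_isSmoothEmbedding_holds
    Literature.Geometry.Symplectic.isPreconnected_sublevel_of_forall_mfderiv_ne_zero_holds

/-- STUB S4 [FLAT FILLING EXCLUSION] — HARDEST; the TRANSFER TARGET C⁺ of the card, Betti-free and
capped through the CANONICAL cap (open; equivalent to the crux given S1–S3 and S5:
`flatFillingExclusion_iff`).  There is NO closed connected symplectic `(N, s)` containing a smoothly
embedded `s`-symplectic genus-2 surface `B = b(S)` (`rank H₁(S) = 4`) with meridian injectivity
(`B·B = +1`) whose complement `U = N ∖ B` is EXACT, FLAT and LIOUVILLE-PACKAGED.  Uncapped: the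
Boothby–Wang contact manifold `(Y_{2,−1}, ξ_BW)` (Euler-number-`(−1)` circle bundle over `Σ₂` =
the link `Σ(2,5,10)` of `z² = x⁵ + y¹⁰`) has NO exact symplectic filling `(W, dλ)` with
`Q_W ⊗ ℚ ≡ 0`.  What the hypotheses hand the prover (via S5 / Disproof §9): `b₂(N) = 1`,
`b₁(N) = 2`, `K = PD[B]`, `c₁(W)` torsion, `b₁(W) = 2`, `χ(W) = 1`, `b⁺(W) = b⁻(W) = 0`,
`b₃(W) = 2 − r`, `r = rank(H₁(Y) → H₁(W)) ∈ {0,1,2}` undecided, `H₂(W; ℚ) = im H₂(Y; ℚ)`, SW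
chamber-free on `N` with basic classes `{0, K}`, the rigid genus-2 curve `B`, no symplectic
spheres, no essential square-`≤ 0` class (Disproof §2), the LOOP FLOOD (card picard-loop-classes).
CONTROLS to separate by FLATNESS (honest exact fillings of the same `(Y, ξ)`): `D₋₁(Σ₂)` Stein
(`b₁ = 4`, `χ = −2`, `Q = (−1)`); `W_k = ((T²×S²)#k\overline{ℂP²}) ∖ ν(B)`, `k ≥ 1` (`b₁ = 2`,
`χ = k+2`, `b⁻ = k+1`; `W₃` passes Chen 2024 T.1–T.3 with INFINITE capacity); `b₁ = 0`: Godeaux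
(`χ = 13`), rational (`χ = 17`), Kunev (`χ = 25`), Milnor fibre of `z²=x⁵+y¹⁰` (`χ = 37`, `b⁺ = 4`,
plane-free).  One genus down the statement is FALSE (`ℂP² ∖ cubic` fills `Y_{1,−9}` with `Q ≡ 0`):
a proof must use `K·B = +1 > 0`.  Proof plans (none complete): (P1) ECH/HM cobordism map of the
exact cobordism `W : (Y, ξ) → ∅` (`Φ_W(∅) = 1`, `Φ_W ∘ U = 0`) against Nelson–Weiler's
`ECH(Y_{2,−1}, ξ_BW)` with its `H₁`-action, using `H₂(W) → H₂(N) = 0`; (P2) SFT neck-stretching of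
the flood curves along `∂ν(B)`; (P3) Chen-type classification with "finite first capacity"
replaced by a consequence of `Q_W ≡ 0 ∧ χ = 1`.  Why it might fail: it is the crux in filling
coordinates — FALSE iff a door exists; short of that every listed tool may be blind (barrier B1:
the smooth near-door complement `W_sm = ((S¹×S³)#(S¹×S³)#ℂP²) ∖ ν(Σ₂)` passes every obstruction
factoring through `(H_*(W), Q_W, restrictions, Spin^c)`; B2: no genus-0 curves through a
general-type cap).  Sources: NelsonWeiler2023 (doi:10.4310/jsg.2023.v21.n6.a1), HutchingsTaubes2013
(arXiv:1111.3324), Chen2024 (arXiv:2404.01105 Thm 1), LiMakYasui (arXiv:1412.3208), Wendl2010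
(arXiv:0806.3193), OhtaOno2005 (doi:10.4310/jdg/1121540338), DorfmeisterLi2010 (arXiv:0805.2957),
Stipsicz2002 (doi:10.1016/s0166-8641(00)00105-x, Rem 3.4), TJLi2015 (arXiv:1511.04831 §4.3.1),
Kotschick2006 (arXiv:math/0504578); Disproof §2, §4, §9, §10.  Size: XL / open. -/
theorem stub_flatFillingExclusion :
    ∀ (N : Type) [TopologicalSpace N] [T2Space N] [SecondCountableTopology N] [CompactSpace N]
      [ConnectedSpace N] [ChartedSpace (𝔼 4) N] [IsManifold (𝓡 4) ∞ N] (s : MForm (𝓡 4) N ℝ 2)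
      (S : Type) [TopologicalSpace S] [T2Space S] [CompactSpace S] [ConnectedSpace S]
      [ChartedSpace (𝔼 2) S] [IsManifold (𝓡 2) ∞ S] (b : S → N) (U : Opens N),
      IsSmoothForm s → IsClosedForm s →
      (∀ x (v : TangentSpace (𝓡 4) x), v ≠ 0 → ∃ w, s x ![v, w] ≠ 0) →
      Module.finrank ℤ (singularHomologyZ S 1) = 4 →
      Manifold.IsSmoothEmbedding (𝓡 2) (𝓡 4) ∞ b →
      (∀ y (v : TangentSpace (𝓡 2) y), v ≠ 0 → ∃ w : TangentSpace (𝓡 2) y,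
        s (b y) ![mfderiv (𝓡 2) (𝓡 4) b y v, mfderiv (𝓡 2) (𝓡 4) b y w] ≠ 0) →
      (U : Set N) = (Set.range b)ᶜ →
      Function.Injective (singularHomology.map ℤ ℤ
        (⟨Subtype.val, continuous_subtype_val⟩ : C(↥(Set.range b)ᶜ, N)) 1) →
      (∃ θ : MForm (𝓡 4) U ℝ 1, IsSmoothForm θ ∧
        mextDeriv θ = s.pullback (𝓡 4) (Subtype.val : U → N)) →
      (∀ x, IsOfFinAddOrder (singularHomology.map ℤ ℤ
        (⟨Subtype.val, continuous_subtype_val⟩ : C(↥(Set.range b)ᶜ, N)) 2 x)) →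
      (∀ V : Set N, IsOpen V → Set.range b ⊆ V →
        ∃ (W : Type) (_ : TopologicalSpace W) (_ : T2Space W) (_ : SecondCountableTopology W)
          (_ : CompactSpace W) (_ : ConnectedSpace W) (_ : ChartedSpace (EuclideanHalfSpace 4) W)
          (_ : IsManifold (𝓡∂ 4) ∞ W) (lam : MForm (𝓡∂ 4) W ℝ 1) (ι : W → N),
          Literature.Geometry.Symplectic.IsLiouvilleDomain W lam ∧
          ContMDiff (𝓡∂ 4) (𝓡 4) ∞ ι ∧ Function.Injective ι ∧
          (∀ x, Function.Injective (mfderiv (𝓡∂ 4) (𝓡 4) ι x)) ∧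
          Set.range ι ⊆ (Set.range b)ᶜ ∧ Vᶜ ⊆ Set.range ι ∧
          mextDeriv lam = s.pullback (𝓡∂ 4) ι) →
      False := by
  sorry

/-- STUB S5 [CLOSING UP] — CLOSED MODULO the tree fact
`Literature.Geometry.Symplectic.canonicalClass_sq_and_adjunction_of_symplectic_four` (`K² = 2χ + 3σ`
and the adjunction equality) — wave 1: conditional `stub_closingUp_of_canonicalClass` + UNCONDITIONAL
`b₂ = 1` half `stub_closingUp_b2`, p94063.  (The card's first lemma `GenusTwoPinsDoor`, generalised: `b₂ = 1` is
DERIVED from flatness; M mathematically, L/XL formally).  Let `(N, s)` be closed connected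
symplectic and `B = b(S)` a smoothly embedded `s`-symplectic genus-2 surface (`rank H₁(S) = 4`)
with meridian injectivity and FLAT complement.  Then `(rank H₁(N), rank H₂(N)) = (2, 1)`: `N` is a
door.  Proof: the pair sequence `H₂(N ∖ B) → H₂(N) → H₂(N, N ∖ B) ≅ H₀(B) ≅ ℤ` (excision + Thom
isomorphism for the oriented normal bundle) with rationally-zero first map gives `b₂(N) ≤ 1`;
meridian injectivity ⟺ `H₂(N) → ℤ` (`x ↦ x·B`) onto, so `b₂(N) = 1`, `H₂/Tors = ℤh`, `h·B = ±1`,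
`[B] = ±h` mod torsion, unimodularity `h² = ±1`, `[s]² > 0` ⇒ `h² = +1`, `B·B = 1`, `b⁺ = 1`,
`b⁻ = 0`, `σ = 1`; `K ≡ kh` characteristic, `k` odd; adjunction for the embedded symplectic genus-2
`B`: `2 = B² + K·B = 1 + k` ⇒ `k = 1`; `k² = K² = c₁² = 2χ + 3σ = 2(3 − 2b₁) + 3` ⇒ `b₁ = 2`
(`closingUp_arith`).  Why it might fail: only through conventions (`Module.finrank ℤ` = free rank);
formally it needs the Thom isomorphism for smooth surfaces in 4-manifolds, the signature theorem
`c₁² = 2χ + 3σ` for almost-complex closed 4-manifolds and the adjunction EQUALITY for embedded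
symplectic surfaces — absent from Mathlib (name them; the tree has `intersectionForm`,
`isPerfPair_intersectionForm`, `GysinMap`, `LefschetzDuality`, `sigPos_add_sigNeg_intersectionForm`,
`Literature.Geometry.Symplectic.AlmostComplexStructure`, `Literature.AlgebraicTopology.CharacteristicClasses`).
The `b₂(N) = 1` half (pair sequence + meridian injectivity + flatness) is the part to land first as
`--supports`.  Tightness: `(Σ₂ ×~ S², S₊)` — genus 2, `S₊² = 1`, meridian-injective, complement NOT
flat, `(b₁, b₂) = (4, 2)`: flatness is load-bearing.  Sources: GompfStipsicz1999 §1.4,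
McDuffSalamon2017 (4.1.7) + Rem 4.1.10 + Ex 4.4.5, MilnorStasheff1974, HatcherAT2002 §3.3; Disproof
§4 `filling_numerics`.  Size: M (L/XL formal). -/
theorem stub_closingUp_closedModulo
    (hA : Literature.Geometry.Symplectic.canonicalClass_sq_and_adjunction_of_symplectic_four) :
    ∀ (N : Type) [TopologicalSpace N] [T2Space N] [SecondCountableTopology N] [CompactSpace N]
      [ConnectedSpace N] [ChartedSpace (𝔼 4) N] [IsManifold (𝓡 4) ∞ N] (s : MForm (𝓡 4) N ℝ 2)
      (S : Type) [TopologicalSpace S] [T2Space S] [CompactSpace S] [ConnectedSpace S]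
      [ChartedSpace (𝔼 2) S] [IsManifold (𝓡 2) ∞ S] (b : S → N),
      IsSmoothForm s → IsClosedForm s →
      (∀ x (v : TangentSpace (𝓡 4) x), v ≠ 0 → ∃ w, s x ![v, w] ≠ 0) →
      Module.finrank ℤ (singularHomologyZ S 1) = 4 →
      Manifold.IsSmoothEmbedding (𝓡 2) (𝓡 4) ∞ b →
      (∀ y (v : TangentSpace (𝓡 2) y), v ≠ 0 → ∃ w : TangentSpace (𝓡 2) y,
        s (b y) ![mfderiv (𝓡 2) (𝓡 4) b y v, mfderiv (𝓡 2) (𝓡 4) b y w] ≠ 0) →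
      Function.Injective (singularHomology.map ℤ ℤ
        (⟨Subtype.val, continuous_subtype_val⟩ : C(↥(Set.range b)ᶜ, N)) 1) →
      (∀ x, IsOfFinAddOrder (singularHomology.map ℤ ℤ
        (⟨Subtype.val, continuous_subtype_val⟩ : C(↥(Set.range b)ᶜ, N)) 2 x)) →
      Module.finrank ℤ (singularHomologyZ N 1) = 2 ∧
        Module.finrank ℤ (singularHomologyZ N 2) = 1 :=
  Summit.SmoothPoincare4.SmoothPoincare4.Theorems.NoGenusTwoDoor.CanonicalCapFilling.stub_closingUp_of_canonicalClass hA

/-! ### Consistency: each named statement IS its registered stub (definitionally) -/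

theorem taubesCanonicalCurve_of_fact
    (hT : Literature.Geometry.Symplectic.taubes_canonicalClass_symplecticCurve_four) :
    TaubesCanonicalCurve := stub_taubesCanonicalCurve_closedModulo hT
theorem taubesCanonicalCurve_of_liLiu
    (hB : Literature.Geometry.Symplectic.hirzebruch_firstChernClass_sq_eq_almostComplex_four)
    (hC₁ : Literature.Geometry.Symplectic.liLiu1995_hasTaubesCurve_canonicalClass_of_bPlus_eq_one) :
    TaubesCanonicalCurve := stub_taubesCanonicalCurve_closedModuloLiLiu hB hC₁
theorem rankOneFlatComplement_holds : RankOneFlatComplement := stub_rankOneFlatComplement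
theorem liouvillePackaging_holds : LiouvillePackaging := stub_liouvillePackaging
theorem liouvillePackaging_of_fact
    (hM : Literature.Geometry.Symplectic.mclean_divisorComplement_convex_four) :
    LiouvillePackaging := stub_liouvillePackaging_closedModulo hM
theorem flatFillingExclusion_holds : FlatFillingExclusion := stub_flatFillingExclusion
theorem closingUp_of_fact
    (hA : Literature.Geometry.Symplectic.canonicalClass_sq_and_adjunction_of_symplectic_four) :
    ClosingUp := stub_closingUp_closedModulo hA

/-! ### The readable abbreviations agree with the unfolded clauses (`Iff.rfl`) -/

theorem isSymplecticMForm_iff {N : Type*} [TopologicalSpace N] [ChartedSpace (𝔼 4) N]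
    (s : MForm (𝓡 4) N ℝ 2) :
    IsSymplecticMForm s ↔ IsSmoothForm s ∧ IsClosedForm s ∧
      ∀ x (v : TangentSpace (𝓡 4) x), v ≠ 0 → ∃ w, s x ![v, w] ≠ 0 := Iff.rfl

theorem meridianInjective_iff (N : Type*) [TopologicalSpace N] (B : Set N) :
    MeridianInjective N B ↔ Function.Injective (singularHomology.map ℤ ℤ
      (⟨Subtype.val, continuous_subtype_val⟩ : C(↥Bᶜ, N)) 1) := Iff.rfl

theorem isFlat_iff (N : Type*) [TopologicalSpace N] (B : Set N) :
    IsFlat N B ↔ ∀ x, IsOfFinAddOrder (singularHomology.map ℤ ℤ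
      (⟨Subtype.val, continuous_subtype_val⟩ : C(↥Bᶜ, N)) 2 x) := Iff.rfl

theorem isExactOn_iff {N : Type*} [TopologicalSpace N] [ChartedSpace (𝔼 4) N]
    (s : MForm (𝓡 4) N ℝ 2) (U : Opens N) :
    IsExactOn s U ↔ ∃ θ : MForm (𝓡 4) U ℝ 1, IsSmoothForm θ ∧
      mextDeriv θ = s.pullback (𝓡 4) (Subtype.val : U → N) := Iff.rfl

/-! ### Name-keyed aliases of the five statements (the hypotheses of the composition) -/
namespace Registered

/-- Alias of `TaubesCanonicalCurve` keyed by the registered stub name. -/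
abbrev stub_taubesCanonicalCurve : Prop := TaubesCanonicalCurve
/-- Alias of `RankOneFlatComplement` keyed by the registered stub name. -/
abbrev stub_rankOneFlatComplement : Prop := RankOneFlatComplement
/-- Alias of `LiouvillePackaging` keyed by the registered stub name. -/
abbrev stub_liouvillePackaging : Prop := LiouvillePackaging
/-- Alias of `FlatFillingExclusion` keyed by the registered stub name. -/
abbrev stub_flatFillingExclusion : Prop := FlatFillingExclusion
/-- Alias of `ClosingUp` keyed by the registered stub name. -/
abbrev stub_closingUp : Prop := ClosingUp

end Registered

/-! ### Glue (proved) -/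

/-- The image of a smooth embedding of a compact surface is closed, so its complement is open. -/
theorem isOpen_compl_range {N : Type*} [TopologicalSpace N] [T2Space N] [ChartedSpace (𝔼 4) N]
    {S : Type*} [TopologicalSpace S] [CompactSpace S] [ChartedSpace (𝔼 2) S] {b : S → N}
    (hb : Manifold.IsSmoothEmbedding (𝓡 2) (𝓡 4) ∞ b) : IsOpen (Set.range b)ᶜ :=
  (isCompact_range hb.isEmbedding.continuous).isClosed.isOpen_compl

/-- The open complement `N ∖ B` as an `Opens N`. -/
def complOpens {N : Type*} [TopologicalSpace N] [T2Space N] [ChartedSpace (𝔼 4) N]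
    {S : Type*} [TopologicalSpace S] [CompactSpace S] [ChartedSpace (𝔼 2) S] {b : S → N}
    (hb : Manifold.IsSmoothEmbedding (𝓡 2) (𝓡 4) ∞ b) : Opens N :=
  ⟨(Set.range b)ᶜ, isOpen_compl_range hb⟩

/-! ### The composition: S1 → S2 → S3 → S4 imply the crux, by name -/

/-- `NoGenusTwoDoor` from the two REGISTERED stubs still formally open after reshapes r3/r4 (S1: a
theorem in print, closed modulo Hirzebruch + Li–Liu; S4: open ⟺ crux) and the tree theorems S2,
S3, by pure logic: a door carries Taubes' canonical genus-2 curve with meridian injectivity (S1);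
at `b₂ = 1` its complement is exact and flat (S2, tree theorem); hence Liouville-packaged (S3,
tree theorem since McLean's fact was discharged); the flat filling exclusion (S4) forbids exactly
this configuration.  No `sorry` here; this is the theorem the skeleton checker reads (hypotheses =
registered stubs by name). -/
theorem NoGenusTwoDoor_of (h1 : Registered.stub_taubesCanonicalCurve)
    (h4 : Registered.stub_flatFillingExclusion) : NoGenusTwoDoor := by
  intro N _ _ _ _ _ _ _ s hsm hcl hnd hdoor
  obtain ⟨hb1, hb2⟩ := hdoor
  obtain ⟨S, i₁, i₂, i₃, i₄, i₅, i₆, b, hS4, hemb, hsnd, hmer⟩ := h1 N s hsm hcl hnd hb1 hb2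
  obtain ⟨hexact, hflat⟩ := rankOneFlatComplement_holds N s S b hsm hcl hnd hb2 hemb hsnd
  have hU : ((complOpens hemb : Opens N) : Set N) = (Set.range b)ᶜ := rfl
  exact h4 N s S b (complOpens hemb) hsm hcl hnd hS4 hemb hsnd hU hmer (hexact _ hU) hflat
    (liouvillePackaging_holds N s S b (complOpens hemb) hsm hcl hnd hemb hsnd hU (hexact _ hU))

/-- Wiring check: the registered stubs feed `NoGenusTwoDoor_of` as stated. -/
example : NoGenusTwoDoor :=
  NoGenusTwoDoor_of stub_taubesCanonicalCurve stub_flatFillingExclusion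

/-- "The crux holds modulo the one remaining named published fact and the flat filling exclusion"
— wrapped in a `def` so that `NoGenusTwoDoor_of` stays the ONLY declaration concluding the crux
directly (the skeleton checker takes the first such). -/
def ClosedModuloFacts : Prop :=
  Literature.Geometry.Symplectic.taubes_canonicalClass_symplecticCurve_four →
  FlatFillingExclusion → NoGenusTwoDoor

/-- **The crux, closed modulo ONE named published fact and the one open stub S4** (reshape r3):
Taubes' canonical-class curve theorem (SW ⇒ Gr, with Li–Liu at `b⁺ = 1`, chamber-free) — a
`def … : Prop` in `Literature/Geometry/Symplectic/` carried as a hypothesis (its discharge is owned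
by literature seats; reduced in the tree to its three printed inputs, `closedModuloPrintedFacts`) —
and the flat filling exclusion (the transfer target C⁺, open ⟺ crux).  S2, S3 and the
connectedness / Milnor-retraction / Thom–Gysin / McLean inputs enter unconditionally.
(Theorems-side copy of the r2 form: `…Theorems.NoGenusTwoDoor.CanonicalCapFilling.
noGenusTwoDoor_of_flatFillingExclusion`, proposal p94693.) -/
theorem closedModuloFacts : ClosedModuloFacts := fun hT h4 =>
  NoGenusTwoDoor_of (taubesCanonicalCurve_of_fact hT) h4

/-- The same modulo EXACTLY the two PRINTED theorems a door consumes (reshape r4): Hirzebruch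
`c₁² = 2χ + 3σ` (closed almost complex `4`-manifolds) and Li–Liu 1995/1999 (`SW ⇒ Gr` for the
canonical class at `b⁺ = 1`); Taubes 1995 Thm. A (1) for `b⁺ ≥ 2` is idle on doors and gone.
Theorems-side twin: `noGenusTwoDoor_of_flatFillingExclusion_of_hirzebruch_of_liLiu` (p142513). -/
def ClosedModuloPrintedFacts : Prop :=
  Literature.Geometry.Symplectic.hirzebruch_firstChernClass_sq_eq_almostComplex_four →
  Literature.Geometry.Symplectic.liLiu1995_hasTaubesCurve_canonicalClass_of_bPlus_eq_one →
  FlatFillingExclusion → NoGenusTwoDoor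

/-- **The crux modulo Hirzebruch, Li–Liu 1995 and S4** (reshape r4):
`NoGenusTwoDoor ⟸ hirzebruch_… ∧ liLiu1995_… ∧ FlatFillingExclusion`. -/
theorem closedModuloPrintedFacts : ClosedModuloPrintedFacts := fun hB hC₁ h4 =>
  NoGenusTwoDoor_of (taubesCanonicalCurve_of_liLiu hB hC₁) h4

/-! ### The converse (S5): no strength is wasted — the transfer is an equivalence -/

/-- **Closing up**: the crux implies the flat filling exclusion (given the statement S5). -/
theorem flatFillingExclusion_of_noGenusTwoDoor (h5 : ClosingUp)
    (hD : NoGenusTwoDoor) : FlatFillingExclusion := by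
  intro N _ _ _ _ _ _ _ s S _ _ _ _ _ _ b U hsm hcl hnd hS4 hemb hsnd _hU hmer _hex hflat _hpack
  obtain ⟨hb1, hb2⟩ := h5 N s S b hsm hcl hnd hS4 hemb hsnd hmer hflat
  exact hD N s hsm hcl hnd ⟨hb1, hb2⟩

/-- **The transfer is lossless**: modulo the printed facts still undischarged (Hirzebruch and
Li–Liu for `⇒`; `K² = 2χ + 3σ` + adjunction for `⇐`), C⁺ = `FlatFillingExclusion` ⟺ the crux
(reshape r4: Taubes 1995 `b⁺ ≥ 2` no longer a hypothesis; the McLean hypothesis left at r3). -/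
theorem flatFillingExclusion_iff
    (hB : Literature.Geometry.Symplectic.hirzebruch_firstChernClass_sq_eq_almostComplex_four)
    (hC₁ : Literature.Geometry.Symplectic.liLiu1995_hasTaubesCurve_canonicalClass_of_bPlus_eq_one)
    (hA : Literature.Geometry.Symplectic.canonicalClass_sq_and_adjunction_of_symplectic_four) :
    FlatFillingExclusion ↔ NoGenusTwoDoor :=
  ⟨fun h4 => closedModuloPrintedFacts hB hC₁ h4,
    flatFillingExclusion_of_noGenusTwoDoor (closingUp_of_fact hA)⟩

/-- The same equivalence modulo the umbrella named fact `taubes_canonicalClass_symplecticCurve_four`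
(one-fact form of r3, kept for the record). -/
theorem flatFillingExclusion_iff_of_fact
    (hT : Literature.Geometry.Symplectic.taubes_canonicalClass_symplecticCurve_four)
    (hA : Literature.Geometry.Symplectic.canonicalClass_sq_and_adjunction_of_symplectic_four) :
    FlatFillingExclusion ↔ NoGenusTwoDoor :=
  ⟨fun h4 => closedModuloFacts hT h4, flatFillingExclusion_of_noGenusTwoDoor (closingUp_of_fact hA)⟩

/-! ### Disproof honoured (imported negative lemma) and sanity instances -/

/-- `[CompactSpace N]` is load-bearing for the crux (landed negative lemma, p74187, IMPORTED). -/
example : ¬ ∀ (N : Type) [TopologicalSpace N] [T2Space N] [SecondCountableTopology N]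
    [ConnectedSpace N] [ChartedSpace (EuclideanSpace ℝ (Fin 4)) N] [IsManifold (𝓡 4) ∞ N]
    (s : MForm (𝓡 4) N ℝ 2), IsSmoothForm s → IsClosedForm s →
    (∀ x (v : TangentSpace (𝓡 4) x), v ≠ 0 → ∃ w, s x ![v, w] ≠ 0) →
    ¬ (Module.finrank ℤ (singularHomologyZ N 1) = 2 ∧ Module.finrank ℤ (singularHomologyZ N 2) = 1) :=
  Summit.SmoothPoincare4.SmoothPoincare4.Theorems.NoGenusTwoDoor.Negative.noGenusTwoDoor_false_without_compact

/-- Sanity (door tuple): `(m, k, b₁) = (1, 1, 2)` satisfies the hypotheses of `closingUp_arith`. -/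
example : (2 : ℤ) = 2 := closingUp_arith (m := 1) (k := 1) rfl (by norm_num) (by norm_num)

/-- Sanity (tightness of meridian injectivity): the numerical ghost `(m, k) = (2, −1)`. -/
example : ((2 : ℤ) = 1 ∧ (-1 : ℤ) = 1) ∨ ((2 : ℤ) = 2 ∧ (-1 : ℤ) = -1) :=
  genusTwo_roots (m := 2) (k := -1) (by norm_num) (by norm_num) ⟨-1, by norm_num⟩

/-- Sanity (controls): the `b₁ = 2` exact fillings `W_k` of Disproof §10 are not flat. -/
example : (2 : ℤ) ≠ 0 := ruled_controls_not_flat (n := 2) (bpos := 1) (by norm_num) (by norm_num) rfl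

end Summit.SmoothPoincare4.SmoothPoincare4.Cruxes.NoGenusTwoDoor.CanonicalCapFilling

end
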